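import Summits.QuantumFields.BalabanUV.Beta.GAN24.TopLagrangeKSlot

/-!
# `BalabanUV.Beta.GAN24.TopLagrangeKSlotLip` — binder row G-an2-4 / (CONV-C), S-slot, PART III rows S3-Lt ∕ R3-dLt: the trilinear functional `lamTopKer`
# of `GAN24/TopLagrangeKSlot` IS BI-LOCALISED AND LIPSCHITZ IN ITS THREE SLOTS (generic part, §3; unit `b2b-balaban-gan24-formalise-leaf-04`, gen 19;
# INTENT «ROW-dLt*» CLAIMS l.4957)

NOT IN PRINT; OUR PROOF ATTEMPT.  HONEST FRAMING (cell contract, verbatim): «discharging `BetaPertH` makes Bałaban's UV stability UNCONDITIONAL — a real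
constructive-QFT result; it is NOT the continuum limit and NOT the Clay problem.»  HONEST DEPENDENCY (verbatim): «continuum YM on T⁴ ⇐ BetaPertH ∧ nine spine
estimates (0/9 proved); BetaPertH ⇐ (D1) ∧ (D4) ∧ CAP+tail; G-an2-4 gates asym, D1 and NE2/3/4.»  [folklore] absolutely convergent lattice sums over an2's
kernel calculus BY NAME (`ExpKernelCalculus.biLoc_comp_decays`, `BalabanStepJetsSucc.biLoc_comp_right`∕`biLoc_mmRead`, `KernelWard.comp_sub_left`∕`comp_sub_right`∕
`biLoc_add`, an5∕asym1's `HessKerRate.comp_sub_comp`∕`biLoc_comp_sub_comp`) and §1–§2 of `GAN24/TopLagrangeKSlot` (`lamTopMid`, `lamTopKer`, `biLoc_lamTopMid`,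
`lamTopMid_sub`; leaf-05-g19's `ThirdJetKernel.mmRead_sub`); generic `d`, `Lc ≥ 1`; two displayed constants (`kerConst`, `lipKerConst`), 0 cite, 0 `def … : Prop`; no estimate of the K-slot;
NOTHING of (hS, hSall)∕«E3Shape»∕«E3SupRate» discharged.  NOT summit progress.

## WHAT IS PROVED
**`biLoc_lamTopKer`** (three slots decaying at rate `δ` ⇒ `lamTopKer Lc K₁ K₂ K₃ κ′ u′` bi-localised at `(u′, u′)`, constant `kerConst`, rate `δ/8`),
`locStencil_lamTopKer`, `comp_sub_comp_bd` (telescoping, bi-localised ∘ decaying — the mirror of `HessKerRate.comp_sub_comp`), **`biLoc_lamTopKer_sub`**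
(deviations `Decays (Kᵢ′ − Kᵢ) εᵢ δ` in the three slots ⇒ the difference is bi-localised with constant `lipKerConst`, LINEAR in `(ε₁, ε₂, ε₃)`, rate `δ/8`).
The rows themselves (`UnitDecayK` ⇒ `hLt`, `CauchyDecayK` ⇒ `dLt`, and `d = 3` from `KSlotAssembly.convCKWall_holds`) are `GAN24/S3DiffLt`.
-/

noncomputable section

open Finset
open scoped BigOperators
open Literature.MathematicalPhysics.QuantumFieldTheory
open Literature.MathematicalPhysics.QuantumFieldTheory.Balaban1983to89
open Literature.MathematicalPhysics.QuantumFieldTheory.Balaban1983to89.Beta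
open B12Sec2to5 (l1 l1_nonneg)
open ExpKernelCalculus (MKer Decays BiLoc comp Zl Zl_nonneg biLoc_comp_decays)
open OneStepResolventKernel (Fib LocStencil decays_mono)
open AveragingHessianKernels (ell)
open BalabanStepJetsSucc (mmRead biLoc_mmRead biLoc_comp_right)
open KernelWard (Bdd bdd_of_decays biLoc_add slices_biLoc_bdd comp_sub_left comp_sub_right)
open HessKerRate (biLoc_comp_sub_comp)
open Summit.QuantumFields.BalabanUV.Beta.GAN24.ThirdJetKernel (mmRead_sub)
open Summit.QuantumFields.BalabanUV.Beta.GAN24.TopLagrangeKSlot (lamTopMid lamTopKer midConst midConst_nonneg biLoc_lamTopMid lamTopMid_sub)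

namespace Summit.QuantumFields.BalabanUV.Beta.GAN24.TopLagrangeKSlotLip

variable {d : ℕ}

/-! ## §3 Bounds: the trilinear functional is bi-localised, and Lipschitz in its three slots -/

section Bounds

variable {Lc : ℕ} [NeZero Lc]

/-- [folklore] The displayed constant of `biLoc_lamTopKer`:
`kerConst d Lc C₁ C₂ C₃ δ = |Fib|·(|Fib|·C₁·midConst(C₂, δ)·Zl(δ/4))·C₃·Zl(δ/8)` (`|Fib| = 2(d+1)`). -/
def kerConst (d Lc : ℕ) (C₁ C₂ C₃ δ : ℝ) : ℝ :=
  (Fintype.card (Fib d) : ℝ) * (((Fintype.card (Fib d) : ℝ) * (C₁ * midConst d Lc C₂ δ) * Zl (d + 1) (δ / 2 - δ / 4)) * C₃) *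
    Zl (d + 1) (δ / 4 - δ / 8)

/-- [folklore] The shape constant is nonnegative for nonnegative data. -/
theorem kerConst_nonneg (Lc : ℕ) {C₁ C₂ C₃ δ : ℝ} (h₁ : 0 ≤ C₁) (h₂ : 0 ≤ C₂) (h₃ : 0 ≤ C₃) (hδ : 0 < δ) :
    0 ≤ kerConst d Lc C₁ C₂ C₃ δ := by
  unfold kerConst
  have := midConst_nonneg (d := d) Lc h₂ hδ
  have := Zl_nonneg (D := d + 1) (show 0 < δ / 2 - δ / 4 by linarith)
  have := Zl_nonneg (D := d + 1) (show 0 < δ / 4 - δ / 8 by linarith)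
  positivity

/-- [folklore] **THE TRILINEAR FUNCTIONAL IS A LOCAL STENCIL ENTRY**: three slots decaying at rate `δ` ⇒ `lamTopKer Lc K₁ K₂ K₃ κ′ u′` is bi-localised at
`(u′, u′)` on the coarse lattice, constant `kerConst`, rate `δ/8` (`biLoc_lamTopMid` → `biLoc_comp_decays` → `biLoc_comp_right` → `biLoc_mmRead`; the rate is
quartered as in an2's `locStencil_e3Of`). -/
theorem biLoc_lamTopKer (hLc : 1 ≤ Lc) {K₁ K₂ K₃ : MKer (d + 1) (Fib d)} {C₁ C₂ C₃ δ : ℝ} (h₁ : Decays K₁ C₁ δ) (h₂ : Decays K₂ C₂ δ)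
    (h₃ : Decays K₃ C₃ δ) (hδ : 0 < δ) (κ' : Fin (d + 1)) (u' : Fin (d + 1) → ℤ) :
    BiLoc (lamTopKer Lc K₁ K₂ K₃ κ' u') u' u' (kerConst d Lc C₁ C₂ C₃ δ) (δ / 8) := by
  have hC₁ : 0 ≤ C₁ := h₁.nonneg (Sum.inl 0)
  have hC₃ : 0 ≤ C₃ := h₃.nonneg (Sum.inl 0)
  have hV := biLoc_lamTopMid hLc h₂ hδ κ' u'
  have h₁' : Decays K₁ C₁ (δ / 2) := decays_mono h₁ hC₁ le_rfl (by linarith)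
  have hc1 := biLoc_comp_decays h₁' hV (show 0 ≤ δ / 4 by linarith) (by linarith)
  have h₃' : Decays K₃ C₃ (δ / 4) := decays_mono h₃ hC₃ le_rfl (by linarith)
  have hc2 := biLoc_comp_right hc1 h₃' (show 0 ≤ δ / 8 by linarith) (by linarith)
  have hm := biLoc_mmRead hLc hc2 (show 0 ≤ δ / 8 by linarith)
  intro x' z' a b
  rw [show lamTopKer Lc K₁ K₂ K₃ κ' u' x' z' a b = -(mmRead Lc (comp (comp K₁ (lamTopMid Lc K₂ κ' u')) K₃) x' z' a b) from rfl,
    abs_neg]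
  exact hm x' z' a b

/-- [folklore] Hence: all three slots `K` ⇒ `lamTopKer Lc K K K` is a LOCAL STENCIL FAMILY (an2's `LocStencil`) on the coarse lattice. -/
theorem locStencil_lamTopKer (hLc : 1 ≤ Lc) {K : MKer (d + 1) (Fib d)} {C δ : ℝ} (hK : Decays K C δ) (hδ : 0 < δ) :
    LocStencil (lamTopKer Lc K K K) (kerConst d Lc C C C δ) (δ / 8) :=
  fun κ' u' => biLoc_lamTopKer hLc hK hK hK hδ κ' u'

/-- [folklore] **TELESCOPING, bi-localised ∘ decaying**: `K∘A − K′∘A′ = (K − K′)∘A + K′∘(A − A′)` (the mirror of an5∕asym1's `HessKerRate.comp_sub_comp`). -/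
theorem comp_sub_comp_bd {K K' A A' : MKer (d + 1) (Fib d)} {Ck Ck' C C' δ : ℝ} {p q : Fin (d + 1) → ℤ} (hK : BiLoc K p q Ck δ)
    (hK' : BiLoc K' p q Ck' δ) (hA : Decays A C δ) (hA' : Decays A' C' δ) (hδ : 0 < δ) :
    comp K A - comp K' A' = comp (K - K') A + comp K' (A - A') := by
  have hAb := bdd_of_decays hA hδ.le
  have hAb' := bdd_of_decays hA' hδ.le
  rw [comp_sub_left (slices_biLoc_bdd hK hAb hδ) (slices_biLoc_bdd hK' hAb hδ),
    comp_sub_right (slices_biLoc_bdd hK' hAb hδ) (slices_biLoc_bdd hK' hAb' hδ)]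
  exact (sub_add_sub_cancel _ _ _).symm

/-- [folklore] The displayed Lipschitz constant of `biLoc_lamTopKer_sub` (LINEAR in the deviations `ε₁, ε₂, ε₃`):
inner difference at rate `δ/4` through `HessKerRate.biLoc_comp_sub_comp`, then `∘ K₃′` and `K₁∘V ∘ (K₃′ − K₃)` through `biLoc_comp_right`. -/
def lipKerConst (d Lc : ℕ) (C₁ C₂ C₂' C₃' δ ε₁ ε₂ ε₃ : ℝ) : ℝ :=
  (Fintype.card (Fib d) : ℝ) *
      (((Fintype.card (Fib d) : ℝ) * (ε₁ * midConst d Lc C₂' δ) * Zl (d + 1) (δ / 2 - δ / 2 / 2) +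
          (Fintype.card (Fib d) : ℝ) * (C₁ * midConst d Lc ε₂ δ) * Zl (d + 1) (δ / 2 - δ / 2 / 2)) * C₃') *
      Zl (d + 1) (δ / 4 - δ / 8) +
    (Fintype.card (Fib d) : ℝ) * (((Fintype.card (Fib d) : ℝ) * (C₁ * midConst d Lc C₂ δ) * Zl (d + 1) (δ / 2 - δ / 4)) * ε₃) *
      Zl (d + 1) (δ / 4 - δ / 8)

/-- [folklore] **THE TRILINEAR FUNCTIONAL IS LIPSCHITZ IN ITS THREE SLOTS**: slots decaying at rate `δ` with constants `C₁, C₂, C₃` (unprimed) and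
`C₁′, C₂′, C₃′` (primed), DEVIATIONS `Decays (Kᵢ′ − Kᵢ) εᵢ δ` ⇒ `lamTopKer Lc K₁′ K₂′ K₃′ κ′ u′ − lamTopKer Lc K₁ K₂ K₃ κ′ u′` is bi-localised at `(u′, u′)`
with constant `lipKerConst C₁ C₂ C₂′ C₃′ δ ε₁ ε₂ ε₃` (each term carries exactly one `εᵢ`), rate `δ/8`.  Mechanism: `mmRead_sub`; `comp_sub_comp_bd` for the outer
right slot; `HessKerRate.biLoc_comp_sub_comp` for `K₁′∘V′ − K₁∘V` with `V′ − V = lamTopMid Lc (K₂′ − K₂)` (`lamTopMid_sub`, `biLoc_lamTopMid`). -/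
theorem biLoc_lamTopKer_sub (hLc : 1 ≤ Lc) {K₁ K₂ K₃ K₁' K₂' K₃' : MKer (d + 1) (Fib d)}
    {C₁ C₂ C₃ C₁' C₂' C₃' ε₁ ε₂ ε₃ δ : ℝ}
    (h₁ : Decays K₁ C₁ δ) (h₂ : Decays K₂ C₂ δ) (h₃ : Decays K₃ C₃ δ)
    (h₁' : Decays K₁' C₁' δ) (h₂' : Decays K₂' C₂' δ) (h₃' : Decays K₃' C₃' δ)
    (hd₁ : Decays (K₁' - K₁) ε₁ δ) (hd₂ : Decays (K₂' - K₂) ε₂ δ) (hd₃ : Decays (K₃' - K₃) ε₃ δ) (hδ : 0 < δ)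
    (κ' : Fin (d + 1)) (u' : Fin (d + 1) → ℤ) :
    BiLoc (lamTopKer Lc K₁' K₂' K₃' κ' u' - lamTopKer Lc K₁ K₂ K₃ κ' u') u' u'
      (lipKerConst d Lc C₁ C₂ C₂' C₃' δ ε₁ ε₂ ε₃) (δ / 8) := by
  have hC₁ : 0 ≤ C₁ := h₁.nonneg (Sum.inl 0)
  have hC₁' : 0 ≤ C₁' := h₁'.nonneg (Sum.inl 0)
  have hC₃ : 0 ≤ C₃ := h₃.nonneg (Sum.inl 0)
  have hC₃' : 0 ≤ C₃' := h₃'.nonneg (Sum.inl 0)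
  have hε₁ : 0 ≤ ε₁ := hd₁.nonneg (Sum.inl 0)
  have hε₃ : 0 ≤ ε₃ := hd₃.nonneg (Sum.inl 0)
  -- the middle slots and their difference (rate δ/2, at the dilated bond)
  have hV := biLoc_lamTopMid hLc h₂ hδ κ' u'
  have hV' := biLoc_lamTopMid hLc h₂' hδ κ' u'
  have hVV : BiLoc (lamTopMid Lc K₂' κ' u' - lamTopMid Lc K₂ κ' u') ((Lc : ℤ) • u') ((Lc : ℤ) • u')
      (midConst d Lc ε₂ δ) (δ / 2) := by
    rw [lamTopMid_sub hLc h₂ h₂' hδ]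
    exact biLoc_lamTopMid hLc hd₂ hδ κ' u'
  -- the left slots at rate δ/2
  have g₁ : Decays K₁ C₁ (δ / 2) := decays_mono h₁ hC₁ le_rfl (by linarith)
  have g₁' : Decays K₁' C₁' (δ / 2) := decays_mono h₁' hC₁' le_rfl (by linarith)
  have gd₁ : Decays (K₁' - K₁) ε₁ (δ / 2) := decays_mono hd₁ hε₁ le_rfl (by linarith)
  -- inner difference `K₁′∘V′ − K₁∘V`, rate δ/4
  have hin := biLoc_comp_sub_comp g₁' g₁ gd₁ hV' hV hVV (half_pos hδ)
  -- the two inner compositions themselves, rate δ/4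
  have hc1 := biLoc_comp_decays g₁ hV (show 0 ≤ δ / 4 by linarith) (by linarith)
  have hc1' := biLoc_comp_decays g₁' hV' (show 0 ≤ δ / 4 by linarith) (by linarith)
  -- the right slots at rate δ/4
  have g₃ : Decays K₃ C₃ (δ / 4) := decays_mono h₃ hC₃ le_rfl (by linarith)
  have g₃' : Decays K₃' C₃' (δ / 4) := decays_mono h₃' hC₃' le_rfl (by linarith)
  have gd₃ : Decays (K₃' - K₃) ε₃ (δ / 4) := decays_mono hd₃ hε₃ le_rfl (by linarith)
  -- telescoping of the outer right slot
  have hin' : BiLoc (comp K₁' (lamTopMid Lc K₂' κ' u') - comp K₁ (lamTopMid Lc K₂ κ' u')) ((Lc : ℤ) • u') ((Lc : ℤ) • u')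
      ((Fintype.card (Fib d) : ℝ) * (ε₁ * midConst d Lc C₂' δ) * Zl (d + 1) (δ / 2 - δ / 2 / 2) +
        (Fintype.card (Fib d) : ℝ) * (C₁ * midConst d Lc ε₂ δ) * Zl (d + 1) (δ / 2 - δ / 2 / 2)) (δ / 4) := by
    have e : δ / 2 / 2 = δ / 4 := by ring
    rw [← e]
    exact hin
  have htel := comp_sub_comp_bd hc1' hc1 g₃' g₃ (show 0 < δ / 4 by linarith)
  have hA := biLoc_comp_right hin' g₃' (show 0 ≤ δ / 8 by linarith) (by linarith)
  have hB := biLoc_comp_right hc1 gd₃ (show 0 ≤ δ / 8 by linarith) (by linarith)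
  have hsum := biLoc_add hA hB
  rw [← htel] at hsum
  have hm := biLoc_mmRead hLc hsum (show 0 ≤ δ / 8 by linarith)
  intro x' z' a b
  have e : (lamTopKer Lc K₁' K₂' K₃' κ' u' - lamTopKer Lc K₁ K₂ K₃ κ' u') x' z' a b =
      -(mmRead Lc (comp (comp K₁' (lamTopMid Lc K₂' κ' u')) K₃' - comp (comp K₁ (lamTopMid Lc K₂ κ' u')) K₃) x' z' a b) := by
    rw [mmRead_sub]
    simp only [lamTopKer, Pi.sub_apply]
    ring
  rw [e, abs_neg]
  exact (hm x' z' a b).trans (le_of_eq (by simp only [lipKerConst]))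

end Bounds

end Summit.QuantumFields.BalabanUV.Beta.GAN24.TopLagrangeKSlotLip

end
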